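import Mathlib
import HarnessLib
import HarnessLib.Audit
import Summits.Parity.Statement
import Literature.NumberTheory.Sieve.SingularSeries
import Summits.Parity.GeneralizedHardyLittlewood.Theorems.LeeYangFibresAssemblyClose
import HarnessLib.Audit.Status.Attr

/-!
Route: HyperbolicConstellations

# Route HyperbolicConstellations — real-rooted constellation polynomials turn binary lower bounds
into the full GHL asymptotic

It suffices to show X = ConstellationHyperbolicity ∧ PairLowerBound ∧ PrimorialPNT (card
newton-inequalities-prime-constellations,
re-pointed from the Poisson regime to the Statement). Data: a one-dimensional system Ψ = (a_i n +
b_i)_{i<t} of size ≤ L at scale N;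
w with L ≤ w and W = primorial(w) ≤ exp((log log N)^{t+1}); an admissible class b mod W; a block
[u,v] ⊆ [−N,N] with
(v−u)(log N)^{t+2} ≥ N on which all forms are positive; the COLLISION-SIFTED class B = {n ∈ [u,v] :
n ≡ b (W), gcd(ψ_i(n), Δ) = 1 ∀i},
Δ = ∏a_i·∏_{i<j}(a_ib_j − a_jb_i). ConstellationHyperbolicity (crux 2): the rank polynomial Σ_j
N_j(B)T^j (N_j = #{n ∈ B : exactly j
of the ψ_i(n) prime}) is real-rooted. PairLowerBound (crux 3): S_ij·|B| ≥ (1 −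
ηϖ^{2t})·r(Ψ,w)·S_iS_j with the sharp constant
r(Ψ,w) = ∏_{p>w, p∤Δ}(1 − 1/(p−1)²) — the existence half of binary Hardy–Littlewood, one-sided.
PrimorialPNT (crux 4): primes are
equidistributed in progressions to moduli ≤ exp((log log x)^C) (Siegel–Walfisz beyond
polylogarithmic moduli). Real-rootedness makes
the number of prime forms a Poisson-binomial law whose top atom N_t/|B| = ∏p_l is pinned by its
first two factorial moments to relative accuracy
O(t²/w) (Cauchy–Schwarz rigidity at the equality case), so singles + the binary lower bound give
every k-point asymptotic on blocks,
summing the classes restores ∏_pβ_p exactly, and DimOne, hence GHL, follows.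
Lean: `ConstellationHyperbolicity ∧ PairLowerBound ∧ PrimorialPNT`

## Assembly
Pure logic (sorry-free in the planner's Sketch.lean, `closes`/`assembly_holds`): SinglesFromPNT
turns PrimorialPNT into SinglesOnBlocks;
HyperbolicTransfer turns ConstellationHyperbolicity, PairLowerBound and SinglesOnBlocks into
TuplesOnBlocks; BlocksToDimOne turns
TuplesOnBlocks and SinglesOnBlocks into DimOne; FibrationLemma gives GeneralizedHardyLittlewood —
`hF (hD (hT hA hP (hSP hN)) (hSP hN))`.
KubiliusModelHyperbolic, the target DimOne and the interface decls SinglesOnBlocks/TuplesOnBlocks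
are hypotheses of `closes` but not
load-bearing.

Rationale: WHY THIS LINE. The card's theorem (KubiliusModelHyperbolic, support): sifting by a prime p > t with
t distinct roots acts on the rank polynomial as
the multiplier j ↦ p − j, i.e. the operator p − X·d/dX, which preserves real-rootedness (Rolle;
Schur–Szegő composition, PolyaSzego1925
Part V, BorceaBranden2009), so the CRT model of every W-tricked, collision-sifted constellation is
hyperbolic prime by prime; crux 2
bets that hyperbolicity survives from sieve level N^θ to √N. New versus the card (Stein–Chen at the
Poisson scale, self-declared
"not an assembly to the summit") and versus Gallagher1976 (who needs k-tuple HL uniformly in k):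
hyperbolicity is used
MULTIPLICATIVELY at fixed t — a real-rooted Σ N_jT^j is c∏(T + r_l), the number of prime forms is Σ
Bernoulli(p_l), Σp_l and
Σ_{l≠l'}p_lp_l' ARE the single and pair counts, and writing p_l = (s/t)(1+u_l) with Σu_l = 0 gives
∏p_l = (s/t)^t e^{−U/2+O(U^{3/2})},
U = Σu_l² = t²(pair deficit) ≤ 2t(t−1)/w + slack (HyperbolicTransfer, provable now) — so the sign
structure of negative dependence
(BorceaBrandenLiggett2007 Thm 4.9, Branden2007 Thm 5.6) replaces every k ≥ 3 correlation input. The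
budget forces the two other
cruxes honestly: DimOne's error is absolute (εN) while ∏_pβ_p(Ψ) ≲ (e^γ log log N)^{t−1} over
systems at scale N, so the transfer's
O(t²/w) must beat (log log N)^{t−1}, i.e. w ≍ (log log N)^{t−1}/ε and W = primorial(w)
super-polylogarithmic — beyond Siegel–Walfisz:
that is crux 4 (only t ≤ 2 assembles inside (log N)^A). Imported: geometry of polynomials / negative
dependence (probability),
Poisson-binomial rigidity; the collision-sifted W-trick is forced by the card's delimiter
(coincident roots mod p break the Rayleigh
property) and is what makes crux 2 shift-uniform as GreenTao2010 Conj. 1.2 demands. No Parity route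
(22 Theses files read; negatives
index: 1 unrelated refutation) uses a shape/sign hypothesis on pattern counts; retired
LeeYangRoughCells put zeros on a univariate
Ω-histogram of one shifted prime.

RANKED CRUXES. #0 DimOne (target) — the d = 1 case of GeneralizedHardyLittlewood
(Dickson–Hardy–Littlewood, Λ-weighted, uniform over non-degenerate systems of size ≤ L and intervals
K ⊆ [−N,N]) — VERBATIM DicksonFibration.DimOne (shared item stmt-Parity-0819); the three cruxes
imply it through the supports SinglesFromPNT, HyperbolicTransfer, BlocksToDimOne. (why it might
fail: = uniform Dickson/HL incl. twins, Sophie Germain, Goldbach in the shift; Siegel-sensitive as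
typed (MatomakiMerikoski2023 Thm 1.3); parity blocks sieves; GTZ vacuous at d = 1.) [GreenTao2010,
MatomakiMerikoski2023, GoldstonSuriajaya2021, HardyLittlewood1923]
#2 ConstellationHyperbolicity (crux) — (card K1/SR in conforming univariate form) for all t ≥ 1, L
there is N₀ such that for N ≥ N₀, every w with L ≤ w and primorial(w) ≤ exp((log log N)^{t+1}),
every non-degenerate d = 1 system Ψ of t forms with ‖Ψ‖_N ≤ L, every block [u,v] ⊆ [−N,N] with
(v−u)(log N)^{t+2} ≥ N on which all forms are positive, and every class b admissible mod W =
primorial w: with Δ = ∏_i a_i ∏_{i<j}(a_ib_j − a_jb_i) and B = {n ∈ [u,v] : n ≡ b (W), gcd(ψ_i(n),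
Δ) = 1 ∀ i}, the rank polynomial Σ_{j≤t} N_j X^j (N_j = #{n ∈ B : exactly j of ψ_1(n),…,ψ_t(n)
prime}) splits over ℝ. At t = 2 it reads 4·N₂·|B| ≤ (S₁+S₂)²: prime pairs are never positively
correlated inside a collision-sifted W-class. [difficulty: open-problem] (why it might fail:
Coefficients span N_0 ≫ N_t, so middle roots need N_t to relative ≈ gap structure; margin shrinks
with w (σ_w ~ 1/(w log w)) and unstructured lower-order terms must stay below ~σ_w^{t/2};
shift-uniform ⇒ false under UnboundedSiegelZeros ((n, n+q₁) lumps χ-classes for q₁ ∤ W).)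
[BorceaBrandenLiggett2007, Branden2007, PolyaSzego1925, GoldstonSuriajaya2021,
MatomakiMerikoski2023, arXiv:0707.2340]
#3 PairLowerBound (crux) — (binary existence half, one-sided, sharp constant) for all t, L and η > 0
there is N₀ with: for N ≥ N₀ and every w, Ψ, block [u,v], admissible b and B as in crux 2, and all i
≠ j, S_ij·|B| ≥ (1 − η·ϖ^{2t})·r(Ψ,w)·S_i·S_j, where S_i = #{n ∈ B : ψ_i(n) prime}, S_ij = #{n ∈ B :
ψ_i(n), ψ_j(n) prime}, r(Ψ,w) = C₂/(∏_{2<p≤w}(1−1/(p−1)²)·∏_{p|Δ, p>w}(1−1/(p−1)²)) = ∏_{p>w, p∤Δ}(1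
− 1/(p−1)²) is the Hardy–Littlewood pair correlation on B (the same for every pair, by collision
sifting), and ϖ = ∏_{p|Δ,p>w}(1−ν_p/p)·φ(W)/W ≤ 1 weights the slack so that it is summable over
classes (ϖ^{t−1}·∏_{p≤w or p|Δ}β_p ≤ 1). Contains the lower bounds for twins, Sophie Germain pairs
and Goldbach pairs n ↦ (n, M − n) uniformly in M ≤ LN; the matching UPPER bounds are not asked (they
follow from crux 2). Job j001440: measured S_ij|B|/(S_iS_j) agrees with r(Ψ,5) to ±0.003 in every
class for six pair systems at N = 10⁸. [difficulty: open-problem] (why it might fail: It is the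
existence half of binary HL with shift-uniformity (twins, Goldbach for every even M ≤ LN):
parity-blocked for all Type-I/II inputs (SelbergParityBarrier, PrimePairParity); false for (n, q₁ −
n) in a Siegel world with χ₁(−1) = −1; no positive lower bound is known for any pair.)
[GreenTao2010, HardyLittlewood1923, Selberg1952Limitations, Ford2004, Polymath8b2014,
MatomakiMerikoski2023]
#4 PrimorialPNT (crux) — (Siegel–Walfisz beyond polylogarithmic moduli) for all C, A and ε > 0 there
is x₀ such that for x ≥ x₀, every modulus 1 ≤ q ≤ exp((log log x)^C), every a coprime to q and every
h with x/(log x)^A ≤ h ≤ x: |#{p prime : x < p ≤ x + h, p ≡ a (q)} − h/(φ(q) log x)| ≤ ε·h/(φ(q) log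
x). C = 1 is the Siegel–Walfisz theorem (in tree: LFunctions.siegel_walfisz_holds); for C > 1 it
asks 1 − β₁ ≥ ω(q)·exp(−(log q)^{1/C}) (ω → ∞ arbitrarily slowly) for the possible real zero β₁ of a
real character of conductor dividing q — beyond Siegel's ineffective q^{−ε} — while all other zeros
are handled by the classical zero-free region and h ≥ x/(log x)^A by the de la Vallée Poussin error
term. It is the route's only multiplicative input: it feeds SinglesOnBlocks for W = primorial(w) ≤
exp((log log N)^{t+1}), the range the transfer's O(t²/w) needs to beat sup_Ψ ∏_p β_p(Ψ) ≍ (log log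
N)^{t−1}. GHL-consistent: by GoldstonSuriajaya2021 Thm 2 the t = 2 case of crux 2 (a shift-uniform
pair UPPER bound with constant < 2 − δ) already forces β₁ < 1 − C/log² q. [difficulty: open-problem]
(why it might fail: Needs 1 − β₁ ≫ exp(−(log q)^{1/C}) for real zeros of real characters of
conductor dividing q: stronger than Siegel's ineffective q^{−ε} and than every effective bound
(Goldfeld–Gross–Zagier ≈ q^{−1/2}), weaker than GRH; the Landau–Siegel problem, open since 1935.)
[IwaniecKowalski2004, GoldstonSuriajaya2021, MatomakiMerikoski2023, HeathBrown1983PrimeTwins,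
Bombieri1965]
#9 SinglesOnBlocks (support) — (consequence of crux 4; proved via SinglesFromPNT) for all t, L, ε >
0 there is N₀ with: uniformly in the data of crux 2, |B| = (1 ± εϖ^t)·(v−u)/W·∏_{p|Δ,p>w}(1 − ν_p/p)
and, for every i, S_i = (1 ± εϖ^t)·(v−u)/(φ(W) log N)·∏_{p|Δ,p>w}(1 − (ν_p−1)/(p−1)), ν_p = #{r mod
p : p | ∏_iψ_i(r)}; in particular S_i/S_j → 1, the near-exchangeability the transfer needs. The
accuracy εϖ^t (ϖ ≥ (log N)^{−o(1)}) is far coarser than the (log log N/log N) a proof delivers. Job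
j001440: |B|/M₀ = 1.0000 in every class; S_i/M₁ = 1 + O(log L/log N) as designed. [difficulty:
open-problem] [IwaniecKowalski2004, HalberstamRichert1974, Bombieri1965,
FriedlanderIwaniecOpera2010]
#9 SinglesFromPNT (support) — PROVABLE: PrimorialPNT → SinglesOnBlocks. The values ψ_i(n), n ≡ b
(W), form a progression of modulus |a_i|W ≤ L·exp((log log N)^{t+1}) with first term coprime to it
(admissibility; primes of a_i are ≤ L ≤ w), so PrimorialPNT (C = t+2) gives the unsifted count; the
sifting by the sparse set {p | Δ, p > w} is a fundamental lemma of dimension ≤ t (tree: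
SieveFrameworkFundamentalLemma / BrunPureSieve) with sifting range z = N^δ and level N^{1/2−ε},
remainders bounded by Bombieri–Vinogradov (tree:
Literature.NumberTheory.Sieve.BombieriVinogradovStatement_holds, an average over ALL moduli ≤
N^{1/2−ε} that covers the subset W·d, d | Δ); collision primes in (N^δ, 2LN] number ≤
t²(1+1/δ)(1+log L) and cost O(N^{1−δ}) each; |B| is the prime-free version (integers in a
progression, trivial level). Choose δ = δ(ε,t). [difficulty: L] [IwaniecKowalski2004,
HalberstamRichert1974, Bombieri1965]
#9 TuplesOnBlocks (support) — (output of the transfer, input of the desieving) for all t, L, ε > 0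
there is N₀ with: uniformly in the data of crux 2, |N_t·|B|^{t−1} − ∏_i S_i| ≤ (8t²/w + εϖ^t)·∏_i
S_i, N_t = #{n ∈ B : all ψ_i(n) prime}. The Hardy–Littlewood value of N_t|B|^{t−1}/∏S_i is D(Ψ,w) =
∏_{p>w,p∤Δ}(1−t/p)(1−1/p)^{−t} ∈ [1 − t²/w, 1] (job j001440: 0.81–0.83 at t = 3, 0.61–0.64 at t = 4
for w = 5, as predicted), whence the allowance 8t²/w; εϖ^t is the summable part. [difficulty:
open-problem] [Dickson1904, HardyLittlewood1923, GreenTao2010]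
#9 HyperbolicTransfer (support) — PROVABLE NOW (Poisson-binomial algebra, ≈ 500 Lean lines):
ConstellationHyperbolicity → PairLowerBound → SinglesOnBlocks → TuplesOnBlocks. A real-rooted
Σ_{j≤t}N_jX^j with N_j ≥ 0, N_0 > 0 is c∏_{l≤m}(X + r_l), r_l > 0 (Polynomial.Splits, roots); with
p_l = 1/(1+r_l): Σp_l = Σ_j jN_j/|B| = Σ_iS_i/|B| =: s, Σ_{l≠l'}p_lp_l' = Σ_j j(j−1)N_j/|B| =
Σ_{i≠j}S_ij/|B|, N_m/|B| = ∏p_l. Put p_l = (s/t)(1+u_l) (Σu_l = 0, U = Σu_l²): PairLowerBound and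
SinglesOnBlocks (S_i = common M₁·(1 ± εϖ^t)) give U ≤ t(t−1)[(1 − r) + ηϖ^{2t}] + 9tε²ϖ^{2t} with 1
− r ≤ Σ_{p>w}(p−1)^{−2} ≤ 2/w; Cauchy–Schwarz Σp_l² ≥ s²/m forces m = t once U < 1; AM–GM and
log(1+u) ≥ u − u² give ∏(1+u_l) ∈ [1 − U, 1] and ∏(S_i/|B|)/(s/t)^t ∈ [1 − Σδ_i², 1]; hence
|N_t|B|^{t−1} − ∏S_i| ≤ (U + 2Σδ²)∏S_i ≤ (8t²/w + ε'ϖ^t)∏S_i. For 8t²/w ≥ 1 only the upper half is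
non-trivial and it needs no smallness. Degenerate cases (S_i = 0, B = ∅, t = 1) are trivial.
[difficulty: provable-now] [BorceaBrandenLiggett2007, PolyaSzego1925]
#9 BlocksToDimOne (support) — PROVABLE (sizable bookkeeping, no arithmetic beyond SinglesOnBlocks):
TuplesOnBlocks → SinglesOnBlocks → DimOne. Given ε take w = ⌈8t²(3e^γ log log N)^{t−1}/ε⌉ (allowed:
primorial w ≤ exp((log log N)^{t+1})). Cut K ∩ ℤ ⊆ [−N,N] at the roots of the forms into ≤ t+1
sign-constant pieces; pieces where a form is ≤ 0 contribute 0 = their β_∞ share; pieces shorter than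
N/(log N)^{t+2} contribute ≤ 2^tN/(log N)²; on long positive pieces split n mod W: non-admissible
classes carry only prime-power values (O(W·t(log N)^{t+1})), prime powers cost O(t√N log^{t+1}N),
tuples with some ψ_i(n) | Δ at most t·ω(Δ) points; on admissible classes TuplesOnBlocks ×
SinglesOnBlocks give N_t(B_b) = M₁^t/M₀^{t−1} ± (8t²/w + 3tεϖ^t)M₁^t/M₀^{t−1}, and Σ_{b
adm}M₁^t/M₀^{t−1} = (v−u)(log N)^{−t}∏_{p≤w}β_p∏_{p|Δ,p>w}β_p because #adm = ∏_{p≤w}(p−ν_p) (CRT),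
localFactor Ψ p = (p/(p−1))^t(1−ν_p/p) at d = 1 and Π₁^tΠ₀^{1−t} = ∏(1−ν_p/p)(1−1/p)^{−t}; the error
sums to ≤ [8t²/w·(3e^γ log log N)^{t−1} + 3tε]·(v−u)(log N)^{−t} since ϖ^t∏β_p ≤ ϖ ≤ 1 and ∏_{p≤w or
p|Δ}β_p ≤ (3e^γ log log N)^{t−1}; the omitted primes p > w, p ∤ Δ have β_p ∈ [1 − t²/p², 1];
singularProduct is the limit (tendsto_singularProductPartial_holds); Λ-weights contribute (log
N)^t(1 + O(t log log N/log N)); archFactor = length of K ∩ {all ψ_i > 0}. [difficulty: L]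
[GreenTao2010, Gallagher1976, HardyLittlewood1923]
#9 FibrationLemma (support) — the fibration lemma DimOne → GeneralizedHardyLittlewood [GreenTao2010,
p. 6: 'holding d − 1 of the variables fixed and summing in the remaining one'] — VERBATIM
DicksonFibration.Assembly / PrimeDeterminantCells.FibrationLemma (shared item stmt-Parity-0822):
unimodular change of basis, fibres of a convex body are intervals, fibre systems are d = 1 systems
with constants ≤ CLN, DimOne on each good fibre with N₀ uniform, fibre singular products average to
∏_pβ_p (CRT + Gallagher tail). [difficulty: L] [GreenTao2010, Gallagher1976]
#9 KubiliusModelHyperbolic (support) — PROVABLE NOW (card P1, the mechanism's anchor; Lean-sized):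
for every k and every finite set P of primes all > k, the model rank polynomial Σ_{j≤k}
C(k,j)·∏_{p∈P}(1 − j/p)·X^j — the expected rank polynomial of k forms with pairwise distinct roots
mod every p ∈ P under the CRT/Kubilius measure — splits over ℝ. Proof: it is ∏_{p∈P} p^{−1}(p −
X·d/dX) applied to (1+X)^k; if f has k < p negative real roots then X f′ − p f = X^{p+1}(X^{−p}f)′
has k−1 Rolle roots between consecutive roots of f (multiplicities counted) and one in (−∞, r_min)
because X^{−p}f → 0 at −∞, so it is again real-rooted with negative roots (equivalently Schur–Szegő
composition with (1+X)^{k−1}(1+(1−k/p)X), PolyaSzego1925 Part V). Delimiter (card): with a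
coincident root mod p the model is not even Rayleigh — whence the collision sifting in B.
[difficulty: provable-now] [PolyaSzego1925, BorceaBranden2009, BorceaBrandenLiggett2007]

TWO-LAYER PLAN. Foreseen glued splits (none filed now): ConstellationHyperbolicity ⇐
LevelThetaHyperbolicity (PROVABLE: the rank polynomial of
z-rough patterns, z ≤ N^{θ(t)}, splits with the model's root gaps, by KubiliusModelHyperbolic + a
t-dimensional fundamental lemma +
openness of simple real-rootedness) → HyperbolicityPropagation (the roots stay real from level N^θ
to √N: the genuine crux, where
certificate methods — common interlacing of the residue-class pieces à la
MarcusSpielmanSrivastava2015, determinantal representations —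
are the intended engine) → ConstellationHyperbolicity. PairLowerBound ⇐ TranslationPairs (a_i = 1) →
AffinePairs (general a_i incl.
Goldbach) → PairLowerBound. PrimorialPNT ⇐ NoSiegelSmooth (real characters of w-smooth conductor
have no zero in [1 − (log q)^{−2}, 1])
→ ExplicitFormulaSmooth (classical region for the rest; tree has the Siegel–Walfisz machinery) →
PrimorialPNT. The card's structural form
SR(S) (real STABILITY of the multi-affine constellation polynomial,
Literature.Combinatorics.StablePolynomials.IsRealStable) implies crux 2
by isRealStable_iff_line and may be filed as a rank-5 certificate crux once crux 2 has a prover.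

KILL CRITERIA. A proof of ¬ConstellationHyperbolicity closes the route
`refuted:ConstellationHyperbolicity` UNLESS the witness is a density-
heterogeneity or collision artefact of the block/sifting conventions (a form with tiny values, an
unsifted prime-power effect, the
w-range): then one `--restate` with the repaired B or range, no second repair. A proof that
shift-uniform pair upper bounds with
constant < 2 are false (UnboundedSiegelZeros made a theorem) kills crux 2, crux 4 AND DimOne as
typed — the sub-problem statement
itself would be Siegel-false and the route closes with it. ¬PairLowerBound refutes GHL (close
refuted, witness to the operator).
¬PrimorialPNT (a Landau–Siegel zero of quality (log q)^{−O(1)}) ⇒ pivot: restate the block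
statements inside Siegel–Walfisz range and
re-target the t ≤ 2 slice (no longer a GHL route; close `superseded`/card). If HyperbolicTransfer or
BlocksToDimOne is shown to need an
input beyond the filed ones, pivot by restating SinglesOnBlocks/TuplesOnBlocks (the only
interfaces). DimOne proved elsewhere
(PrimeDeterminantCells, DicksonFibration siblings) moots the route.

NOT DECOMPOSED YET. The level-θ theorem and the propagation step (children of crux 2); the
translation/affine split of crux 3; the no-Siegel/explicit-
formula split of crux 4; the multi-affine SR certificate; quantitative trade-offs (the exponents 2t,
t in the ϖ-weights are generous,
not optimal); the Poisson-scale by-products of the card (variance floor K2, K3 along primorial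
progressions — not on the path to the
Statement, they stay on the card); a Literature home for `collisionSiftedClass`/`constellationRank`
(would shorten every signature; not
prerequisite: all items elaborate with inline lets, rc 0).

CHEAPEST FALSIFIER. RUN (kit job j001440, N = 10⁸, W = 30, block (N/2,N], script
kit/hyperbolic_check.py): t = 2 discriminant test 4N₂|B| ≤ (S₁+S₂)² for
twins (max 0.940), collision-sifted smooth shifts h = 2·7·11·13 (0.985) and 2·7⋯23 (0.992), Sophie
Germain (0.938), Goldbach M = 10⁸+8
(0.940, 6 classes) and M = 223092870 primorial (0.993, 8 classes) — all real-rooted, and the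
measured pair ratio S₁₂|B|/(S₁S₂) equals the
collision-sifted prediction r(Ψ,5) to ±0.003 in every class (0.9389 / 0.9823 / 0.9913); t = 3
systems (n,n+2,n+6), (n,n+2,2n+1),
(n,n+2,n+2004) real in every class with N₃|B|²/∏S = 0.80–0.83 ≈ D₃(5); t = 4: (n,n+6,n+12,n+18)
real, but the dense quadruple
(n,n+2,n+6,n+8) has a complex pair in its one class (|Im z|/|z| = 0.11) and so does one class of the
k = 5 tuple — N₄ ≈ 1.7·10³ there,
i.e. 2.4% Poisson noise on the top coefficient, amplified by |T|⁴ at the middle roots: the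
noise-limited regime, consistent with the
card's real k ≤ 4 runs at W ∈ {2,6} (jobs j000165, j000212, j000218, j000299). Next: the same test
at N = 10¹⁰–10¹¹ for
t = 4, 5 (noise 0.2%), and the t = 2 Goldbach family over 10³ consecutive even M (a single negative
discriminant margin beyond noise
kills crux 2).

NUMBERS. σ_w = Σ_{p>w} 1/p²: σ_5 ≈ 0.045, σ_30 ≈ 0.0077; pair prediction r(Ψ,5) = 0.9389 (p ∤ Δ),
0.9823 (7,11,13 | Δ), 0.9913 (7…23 | Δ) —
measured to ±0.003 (j001440). D_t(5) = ∏_{p>5}(1−t/p)(1−1/p)^{−t}: 0.81 (t=3), ≈0.6 (t=4), measured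
0.80–0.83 / 0.61–0.64. Transfer
accuracy O(t²/w) vs the singular-series ceiling sup_Ψ∏_pβ_p ≲ (e^γ log log N)^{t−1}: w ≍ (log log
N)^{t−1}/ε, W = e^{(1+o(1))w} — inside
(log N)^A only for t ≤ 2, hence crux 4. Crux 2 at t = 2 is a shift-uniform pair UPPER bound with
constant (1+O(σ_w))(AM/GM)² — far below
the 2 − δ of HLPrimePairUpperBoundConj and every sieve record (Lichtman 3.2996, Wu 3.3996 for twins
in units of Π(x)); under EH the
Selberg sieve gives 2 + ε, so even EH does not prove the t = 2 case. Items at open: 12 (3 cruxes, 1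
target, 7 support, 1 assembly).

DEFINITION REQUESTS. None prerequisite. Optional (would shorten all block statements):
`collisionSiftedClass Ψ u v w b : Finset ℤ` and
`constellationRank Ψ B j : ℕ` under Summits/Parity/GeneralizedHardyLittlewood/Theorems
(route-posited objects,
HyperbolicConstellationsDefs.lean) — to be filed by the first prover of HyperbolicTransfer, not now.

Novelty: Searches (2026-08-15): card's own battery (zbMATH 'strongly Rayleigh primes', 'real stable
polynomial primes sieve', 'negative dependence prime k-tuples', 'Chen-Stein primes' — 0 relevant;
crossref 'Poisson approximation prime k-tuples' → Ford IMRN 2025 on ω(p−1); lit frontier Parity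
--since 2023, 30 rows); this session: `lit galaxy search "strongly Rayleigh" --star all` (25 rows:
Lyons–Peres, Pemantle's survey arXiv:1210.3231, Brändén–Huh arXiv:1902.03719, Oxley, DPP sampling —
no number theory), `lit galaxy search --star pdf --mode bm25 "Poisson binomial distribution prime
k-tuples"` (12 rows, course notes, 0 relevant), `lit galaxy search --star pdf --mode bm25 "prime
k-tuples from pair correlations negative association Landau-Siegel"` (12 rows: Conrey RMT survey,
Stopple arXiv:1108.6272 on Deuring–Heilbronn, 0 on the mechanism), `lit search "strong Rayleigh
property central limit theorem real-rooted generating polynomial"` and `lit search "negative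
dependence prime k-tuples Hardy-Littlewood real-rooted polynomial"` (searchd rc 75 twice at filing —
to re-run by the auditor), ledger negatives --problem Parity (1, unrelated), all 22 Theses files of
the sub read.
Nearest prior art found: BorceaBrandenLiggett2007 (arXiv:0707.2340: SR ⇒ negative association;
exchangeable case ⇔ ULC) and Branden2007 — the dependence theory, no arithmetic instance;
Gallagher1976 (uniform k-tuple HL ⇒ Poisson law: consumes all k); Pemantle's survey arXiv:1210.3231
§§4–5 (real-rooted generating poly  [refs: 1210.3231, 1902.03719, 1108.6272, 0707.2340, BorceaBrandenLiggett2007, Branden2007, Gallagher1976, GoldstonSuriajaya2021]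

Barriers (technique_class: geometry-of-polynomials, negative-dependence, w-trick): - technique_class: geometry-of-polynomials, negative-dependence, w-trick
- Literature.Barriers.Parity.SelbergParityBarrier: not evaded for crux 3 (the binary lower bound is
exactly what no Type-I input gives); crux 2 is a SIGN statement (upper-bound side only: it holds in
every ghost world with δ ≤ 1 and fails for δ > 1+σ_w), not a sieve lower bound, so the barrier does
not bear on it; the bet is that hyperbolicity admits certificates (interlacing, determinantal
representations) rather than estimates.
- Literature.Barriers.Parity.PrimePairParity: same split — weight insertion ω = 1 − λ(n)λ(n+2) kills
twins but PRESERVES crux 2 (fewer coincidences keep the rank polynomial real-rooted), so no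
existence claim is smuggled through the shape inequality; existence enters only via crux 3, conceded
parity-blocked.
- Literature.Barriers.Parity.SiegelZeroPrimePairBarrier: met head-on and named: crux 4 IS the Siegel
issue, isolated; crux 2 at t = 2 is a shift-uniform pair upper bound with constant ≈ 1 < 2 − δ,
hence (Goldston–Suriajaya Thm 2) implies β₁ < 1 − C/log² q, which is what crux 4 needs — the route
inherits exactly the Statement's own Siegel-sensitivity (MatomakiMerikoski2023_fixedShift;
UnboundedSiegelZeros would refute DimOne as typed), no more: fixed-system versions of cruxes 2–3 are
Siegel-consistent.
- Literature.Barriers.Parity.HensleyRichards1974: not met — no claim of convexity (A); crux 2 bounds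
t-tuple counts above by products of singles inside one W-class, compatible

sub-problem: GeneralizedHardyLittlewood · status: done · opened planner-plancard-Parity-GeneralizedHardyLittl-3b73a515-0 2026-08-15T15:13:33Z · rev 0 · ledger route-Parity-HyperbolicConstellations
GENERATED by the gate from the ledger (D-0016/17). Provers cite these decls: `theorem foo : Summit.Parity.GeneralizedHardyLittlewood.Theses.HyperbolicConstellations.<Decl> := …` in Summits/Parity/GeneralizedHardyLittlewood/Theorems/<Name>.lean.
-/

namespace Summit.Parity.GeneralizedHardyLittlewood.Theses.HyperbolicConstellations

open scoped BigOperators Topology Manifold Classical MeasureTheory ProbabilityTheory Matrix InnerProductSpace ComplexConjugate ContinuousMap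
open Filter Set Function TopologicalSpace MeasureTheory

attribute [summit_statement] _root_.GeneralizedHardyLittlewood

/-- item stmt-Parity-0819 · target · rank 0 · open · by planner
why it might fail: = uniform Dickson/HL incl. twins, Sophie Germain, Goldbach in the shift; Siegel-sensitive as typed (MatomakiMerikoski2023 Thm 1.3); parity blocks sieves; GTZ vacuous at d = 1.
sources: GreenTao2010, MatomakiMerikoski2023, GoldstonSuriajaya2021, HardyLittlewood1923
[crux] The d = 1 case of Literature.NumberTheory.Sieve.GeneralizedHardyLittlewood
(Dickson–Hardy–Littlewood, Λ-weighted): for all t ≥ 1, L, uniformly over non-degenerate systems of t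
forms a_i n + b_i with ‖Ψ‖_N ≤ L (so |b_i| ≤ L N) and intervals K ⊆ [-N, N]: |∑_{n ∈ K} ∏ Λ(a_i n +
b_i) − β_∞ ∏_p β_p| ≤ ε N for N ≥ N₀(t, L, ε). Open (contains twin primes, Sophie Germain, Goldbach
asymptotics uniformly in the shift). GHL → DimOne is immediate; the route's content is the converse
(Assembly). [GreenTao2010, Conj. 1.2, p. 6] -/
@[route_item "route-Parity-HyperbolicConstellations", crux]
def DimOne : Prop :=
  ∀ (t L : ℕ), 1 ≤ t → ∀ ε : ℝ, 0 < ε → ∃ N₀ : ℕ, ∀ N : ℕ, N₀ ≤ N → ∀ Ψ : Fin t → Literature.NumberTheory.Sieve.AffLinForm 1, Literature.NumberTheory.Sieve.IsNondegenerateSystem Ψ → Literature.NumberTheory.Sieve.affLinSize Ψ N ≤ L → ∀ K : Set (Fin 1 → ℝ), Convex ℝ K → K ⊆ Literature.NumberTheory.Sieve.realBox 1 N → |Literature.NumberTheory.Sieve.vonMangoldtSum Ψ K N - Literature.NumberTheory.Sieve.archFactor Ψ K * Literature.NumberTheory.Sieve.singularProduct Ψ| ≤ ε * (N : ℝ)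

/-- item stmt-Parity-10134 · crux · rank 2 · open · by planner
why it might fail: Coefficients span N_0 ≫ N_t, so middle roots need N_t to relative ≈ gap structure; margin shrinks with w (σ_w ~ 1/(w log w)) and unstructured lower-order terms must stay below ~σ_w^{t/2}; shift-uniform ⇒ false under UnboundedSiegelZeros ((n, n+q₁) lumps χ-classes for q₁ ∤ W).
sources: BorceaBrandenLiggett2007, Branden2007, PolyaSzego1925, GoldstonSuriajaya2021, MatomakiMerikoski2023, arXiv:0707.2340
[crux] (card K1/SR in conforming univariate form) for all t ≥ 1, L there is N₀ such that for N ≥ N₀,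
every w with L ≤ w and primorial(w) ≤ exp((log log N)^{t+1}), every non-degenerate d = 1 system Ψ of
t forms with ‖Ψ‖_N ≤ L, every block [u,v] ⊆ [−N,N] with (v−u)(log N)^{t+2} ≥ N on which all forms
are positive, and every class b admissible mod W = primorial w: with Δ = ∏_i a_i ∏_{i<j}(a_ib_j −
a_jb_i) and B = {n ∈ [u,v] : n ≡ b (W), gcd(ψ_i(n), Δ) = 1 ∀ i}, the rank polynomial Σ_{j≤t} N_j X^j
(N_j = #{n ∈ B : exactly j of ψ_1(n),…,ψ_t(n) prime}) splits over ℝ. At t = 2 it reads 4·N₂·|B| ≤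
(S₁+S₂)²: prime pairs are never positively correlated inside a collision-sifted W-class.
[difficulty: open-problem] -/
@[route_item "route-Parity-HyperbolicConstellations", crux]
def ConstellationHyperbolicity : Prop :=
  ∀ (t L : ℕ), 1 ≤ t → ∃ N₀ : ℕ, ∀ N : ℕ, N₀ ≤ N → ∀ w : ℕ, L ≤ w → (primorial w : ℝ) ≤ Real.exp (Real.log (Real.log N) ^ (t + 1)) → ∀ Ψ : Fin t → Literature.NumberTheory.Sieve.AffLinForm 1, Literature.NumberTheory.Sieve.IsNondegenerateSystem Ψ → Literature.NumberTheory.Sieve.affLinSize Ψ N ≤ L → ∀ (u v b : ℤ), -(N : ℤ) ≤ u → v ≤ N → (N : ℝ) ≤ (v - u : ℝ) * Real.log N ^ (t + 2) → (∀ i, 0 < (Ψ i).eval (fun _ => u) ∧ 0 < (Ψ i).eval (fun _ => v)) → (∀ i, Int.gcd ((Ψ i).eval (fun _ => b)) (primorial w) = 1) → (let Δ : ℤ := (∏ i, (Ψ i).coeff 0) * ∏ i, ∏ j, (if i < j then (Ψ i).coeff 0 * (Ψ j).const - (Ψ j).coeff 0 * (Ψ i).const else 1); let B : Finset ℤ :=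 (Finset.Icc u v).filter (fun n => n ≡ b [ZMOD (primorial w : ℤ)] ∧ ∀ i, Int.gcd ((Ψ i).eval (fun _ => n)) Δ = 1); (∑ j ∈ Finset.range (t + 1), Polynomial.C ((((B.filter (fun n => (Finset.univ.filter (fun i => ((Ψ i).eval (fun _ => n)).toNat.Prime)).card = j)).card : ℕ)) : ℝ) * Polynomial.X ^ j).Splits)

/-- item stmt-Parity-10135 · crux · rank 3 · open · by planner
why it might fail: It is the existence half of binary HL with shift-uniformity (twins, Goldbach for every even M ≤ LN): parity-blocked for all Type-I/II inputs (SelbergParityBarrier, PrimePairParity); false for (n, q₁ − n) in a Siegel world with χ₁(−1) = −1; no positive lower bound is known for any pair.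
sources: GreenTao2010, HardyLittlewood1923, Selberg1952Limitations, Ford2004, Polymath8b2014, MatomakiMerikoski2023
[crux] (binary existence half, one-sided, sharp constant) for all t, L and η > 0 there is N₀ with:
for N ≥ N₀ and every w, Ψ, block [u,v], admissible b and B as in crux 2, and all i ≠ j, S_ij·|B| ≥
(1 − η·ϖ^{2t})·r(Ψ,w)·S_i·S_j, where S_i = #{n ∈ B : ψ_i(n) prime}, S_ij = #{n ∈ B : ψ_i(n), ψ_j(n)
prime}, r(Ψ,w) = C₂/(∏_{2<p≤w}(1−1/(p−1)²)·∏_{p|Δ, p>w}(1−1/(p−1)²)) = ∏_{p>w, p∤Δ}(1 − 1/(p−1)²) is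
the Hardy–Littlewood pair correlation on B (the same for every pair, by collision sifting), and ϖ =
∏_{p|Δ,p>w}(1−ν_p/p)·φ(W)/W ≤ 1 weights the slack so that it is summable over classes
(ϖ^{t−1}·∏_{p≤w or p|Δ}β_p ≤ 1). Contains the lower bounds for twins, Sophie Germain pairs and
Goldbach pairs n ↦ (n, M − n) uniformly in M ≤ LN; the matching UPPER bounds are not asked (they
follow from crux 2). Job j001440: measured S_ij|B|/(S_iS_j) agrees with r(Ψ,5) to ±0.003 in every
class for six pair systems at N = 10⁸. [difficulty: open-problem] -/
@[route_item "route-Parity-HyperbolicConstellations", crux]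
def PairLowerBound : Prop :=
  ∀ (t L : ℕ), 1 ≤ t → ∀ η : ℝ, 0 < η → ∃ N₀ : ℕ, ∀ N : ℕ, N₀ ≤ N → ∀ w : ℕ, L ≤ w → (primorial w : ℝ) ≤ Real.exp (Real.log (Real.log N) ^ (t + 1)) → ∀ Ψ : Fin t → Literature.NumberTheory.Sieve.AffLinForm 1, Literature.NumberTheory.Sieve.IsNondegenerateSystem Ψ → Literature.NumberTheory.Sieve.affLinSize Ψ N ≤ L → ∀ (u v b : ℤ), -(N : ℤ) ≤ u → v ≤ N → (N : ℝ) ≤ (v - u : ℝ) * Real.log N ^ (t + 2) → (∀ i, 0 < (Ψ i).eval (fun _ => u) ∧ 0 < (Ψ i).eval (fun _ => v)) → (∀ i, Int.gcd ((Ψ i).eval (fun _ => b)) (primorial w) = 1) → (let Δ : ℤ := (∏ i, (Ψ i).coeff 0) * ∏ i, ∏ j, (if i < j then (Ψ i).coeff 0 * (Ψ j).const - (Ψ j).coeff 0 * (Ψ i).const else 1); let B : Finset ℤ := (Finset.Icc u v).filter (fun n => n ≡ b [ZMOD (primorial w : ℤ)] ∧ ∀ i, Int.gcd ((Ψ i).eval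 (fun _ => n)) Δ = 1); let ν : ℕ → ℕ := fun p => ((Finset.range p).filter (fun r => (p : ℤ) ∣ ∏ i, (Ψ i).eval (fun _ => (r : ℤ)))).card; let P : Finset ℕ := (Int.natAbs Δ).primeFactors.filter (fun p => w < p); let c₀ : ℝ := ∏ p ∈ P, (1 - (ν p : ℝ) / (p : ℝ)); let ϖ : ℝ := c₀ * (Nat.totient (primorial w) : ℝ) / (primorial w : ℝ); let r : ℝ := Literature.NumberTheory.Sieve.twinPrimeConst / (Literature.NumberTheory.Sieve.twinPrimeConstPartial w * ∏ p ∈ P, (1 - 1 / ((p : ℝ) - 1) ^ 2)); ∀ i j : Fin t, i ≠ j → (1 - η * ϖ ^ (2 * t)) * r * ((B.filter (fun n => ((Ψ i).eval (fun _ => n)).toNat.Prime)).card : ℝ) * ((B.filter (fun n => ((Ψ j).eval (fun _ => n)).toNat.Prime)).card : ℝ) ≤ ((B.filter (fun n => ((Ψ i).eval (fun _ => n)).toNat.Prime ∧ ((Ψ j).eval (fun _ => n)).toNat.Prime)).card : ℝ) * (B.card : ℝ))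

/-- item stmt-Parity-10136 · crux · rank 4 · open · by planner
why it might fail: Needs 1 − β₁ ≫ exp(−(log q)^{1/C}) for real zeros of real characters of conductor dividing q: stronger than Siegel's ineffective q^{−ε} and than every effective bound (Goldfeld–Gross–Zagier ≈ q^{−1/2}), weaker than GRH; the Landau–Siegel problem, open since 1935.
sources: IwaniecKowalski2004, GoldstonSuriajaya2021, MatomakiMerikoski2023, HeathBrown1983PrimeTwins, Bombieri1965
[crux] (Siegel–Walfisz beyond polylogarithmic moduli) for all C, A and ε > 0 there is x₀ such that
for x ≥ x₀, every modulus 1 ≤ q ≤ exp((log log x)^C), every a coprime to q and every h with x/(log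
x)^A ≤ h ≤ x: |#{p prime : x < p ≤ x + h, p ≡ a (q)} − h/(φ(q) log x)| ≤ ε·h/(φ(q) log x). C = 1 is
the Siegel–Walfisz theorem (in tree: LFunctions.siegel_walfisz_holds); for C > 1 it asks 1 − β₁ ≥
ω(q)·exp(−(log q)^{1/C}) (ω → ∞ arbitrarily slowly) for the possible real zero β₁ of a real
character of conductor dividing q — beyond Siegel's ineffective q^{−ε} — while all other zeros are
handled by the classical zero-free region and h ≥ x/(log x)^A by the de la Vallée Poussin error
term. It is the route's only multiplicative input: it feeds SinglesOnBlocks for W = primorial(w) ≤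
exp((log log N)^{t+1}), the range the transfer's O(t²/w) needs to beat sup_Ψ ∏_p β_p(Ψ) ≍ (log log
N)^{t−1}. GHL-consistent: by GoldstonSuriajaya2021 Thm 2 the t = 2 case of crux 2 (a shift-uniform
pair UPPER bound with constant < 2 − δ) already forces β₁ < 1 − C/log² q. [difficulty: open-problem] -/
@[route_item "route-Parity-HyperbolicConstellations", crux]
def PrimorialPNT : Prop :=
  ∀ C A : ℕ, ∀ ε : ℝ, 0 < ε → ∃ x₀ : ℝ, ∀ x : ℝ, x₀ ≤ x → ∀ q : ℕ, 1 ≤ q → (q : ℝ) ≤ Real.exp (Real.log (Real.log x) ^ C) → ∀ a : ℕ, Nat.Coprime a q → ∀ h : ℝ, x / Real.log x ^ A ≤ h → h ≤ x → |((((Finset.Ioc ⌊x⌋₊ ⌊x + h⌋₊).filter (fun p => p.Prime ∧ p ≡ a [MOD q])).card : ℕ) : ℝ) - h / ((Nat.totient q : ℝ) * Real.log x)| ≤ ε * (h / ((Nat.totient q : ℝ) * Real.log x))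

/-- item stmt-Parity-0822 · support · rank 9 · closed · proved by Summit.Parity.GeneralizedHardyLittlewood.Theorems.leeYangFibres_fibrationLemma (prover) · by planner
sources: GreenTao2010, Gallagher1976
[assembly] The fibration lemma DimOne → GeneralizedHardyLittlewood [GreenTao2010, p. 6: 'holding d −
1 of the variables fixed and summing in the remaining one']. PROVABLE but sizable: (i) unimodular
change of basis of ℤ^d making every linear part non-vanishing on e₁ (affLinSize and realBox change
by C(d,t,L): rescale N); (ii) fibres K_w = K ∩ (w + ℝe₁) are intervals ⊆ [-CN, CN], fibre systems
are d = 1 systems with constants ≤ C L N, non-degenerate off O_t(N^{d−2}) fibres (trivial bound N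
log^t N on those); (iii) DimOne on each good fibre with N₀ uniform in w; (iv) main terms ∑_w |K_w ∩
{Ψ_w > 0}|·∏_p β_p(Ψ_w) = β_∞ ∏_p β_p + o(N^d) via FibreSingularProduct-type averaging weighted by
fibre lengths [GreenTao2010, App. A]. -/
@[route_item "route-Parity-HyperbolicConstellations", crux]
def FibrationLemma : Prop :=
  DimOne → GeneralizedHardyLittlewood

/-- `FibrationLemma` holds: proved by `Summit.Parity.GeneralizedHardyLittlewood.Theorems.leeYangFibres_fibrationLemma`. -/
theorem FibrationLemma_holds : FibrationLemma := _root_.Summit.Parity.GeneralizedHardyLittlewood.Theorems.leeYangFibres_fibrationLemma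

/-- item stmt-Parity-10137 · support · rank 9 · open · by planner
sources: IwaniecKowalski2004, HalberstamRichert1974, Bombieri1965, FriedlanderIwaniecOpera2010
[support] (consequence of crux 4; proved via SinglesFromPNT) for all t, L, ε > 0 there is N₀ with:
uniformly in the data of crux 2, |B| = (1 ± εϖ^t)·(v−u)/W·∏_{p|Δ,p>w}(1 − ν_p/p) and, for every i,
S_i = (1 ± εϖ^t)·(v−u)/(φ(W) log N)·∏_{p|Δ,p>w}(1 − (ν_p−1)/(p−1)), ν_p = #{r mod p : p |
∏_iψ_i(r)}; in particular S_i/S_j → 1, the near-exchangeability the transfer needs. The accuracy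
εϖ^t (ϖ ≥ (log N)^{−o(1)}) is far coarser than the (log log N/log N) a proof delivers. Job j001440:
|B|/M₀ = 1.0000 in every class; S_i/M₁ = 1 + O(log L/log N) as designed. [difficulty: open-problem] -/
@[route_item "route-Parity-HyperbolicConstellations", crux]
def SinglesOnBlocks : Prop :=
  ∀ (t L : ℕ), 1 ≤ t → ∀ ε : ℝ, 0 < ε → ∃ N₀ : ℕ, ∀ N : ℕ, N₀ ≤ N → ∀ w : ℕ, L ≤ w → (primorial w : ℝ) ≤ Real.exp (Real.log (Real.log N) ^ (t + 1)) → ∀ Ψ : Fin t → Literature.NumberTheory.Sieve.AffLinForm 1, Literature.NumberTheory.Sieve.IsNondegenerateSystem Ψ → Literature.NumberTheory.Sieve.affLinSize Ψ N ≤ L → ∀ (u v b : ℤ), -(N : ℤ) ≤ u → v ≤ N → (N : ℝ) ≤ (v - u : ℝ) * Real.log N ^ (t + 2) → (∀ i, 0 < (Ψ i).eval (fun _ => u) ∧ 0 < (Ψ i).eval (fun _ => v)) → (∀ i, Int.gcd ((Ψ i).eval (fun _ => b)) (primorial w) = 1) → (let Δ : ℤ := (∏ i, (Ψ i).coeff 0)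 * ∏ i, ∏ j, (if i < j then (Ψ i).coeff 0 * (Ψ j).const - (Ψ j).coeff 0 * (Ψ i).const else 1); let B : Finset ℤ := (Finset.Icc u v).filter (fun n => n ≡ b [ZMOD (primorial w : ℤ)] ∧ ∀ i, Int.gcd ((Ψ i).eval (fun _ => n)) Δ = 1); let ν : ℕ → ℕ := fun p => ((Finset.range p).filter (fun r => (p : ℤ) ∣ ∏ i, (Ψ i).eval (fun _ => (r : ℤ)))).card; let P : Finset ℕ := (Int.natAbs Δ).primeFactors.filter (fun p => w < p); let c₀ : ℝ := ∏ p ∈ P, (1 - (ν p : ℝ) / (p : ℝ)); let ϖ : ℝ := c₀ * (Nat.totient (primorial w) : ℝ) / (primorial w : ℝ); let M₀ : ℝ := (v - u : ℝ) / (primorial w : ℝ) * c₀; let M₁ : ℝ := (v - u : ℝ) / (Nat.totient (primorial w) : ℝ) / Real.log N * ∏ p ∈ P, (1 - ((ν p : ℝ) - 1) / ((p : ℝ) - 1)); |(B.card : ℝ) - M₀| ≤ ε * ϖ ^ t * M₀ ∧ ∀ i, |((B.filter (fun n => ((Ψ i).eval (fun _ => n)).toNat.Prime)).card : ℝ) -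 M₁| ≤ ε * ϖ ^ t * M₁)

/-- item stmt-Parity-10138 · support · rank 9 · open · by planner
sources: IwaniecKowalski2004, HalberstamRichert1974, Bombieri1965
[support] PROVABLE: PrimorialPNT → SinglesOnBlocks. The values ψ_i(n), n ≡ b (W), form a progression
of modulus |a_i|W ≤ L·exp((log log N)^{t+1}) with first term coprime to it (admissibility; primes of
a_i are ≤ L ≤ w), so PrimorialPNT (C = t+2) gives the unsifted count; the sifting by the sparse set
{p | Δ, p > w} is a fundamental lemma of dimension ≤ t (tree: SieveFrameworkFundamentalLemma /
BrunPureSieve) with sifting range z = N^δ and level N^{1/2−ε}, remainders bounded by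
Bombieri–Vinogradov (tree: Literature.NumberTheory.Sieve.BombieriVinogradovStatement_holds, an
average over ALL moduli ≤ N^{1/2−ε} that covers the subset W·d, d | Δ); collision primes in (N^δ,
2LN] number ≤ t²(1+1/δ)(1+log L) and cost O(N^{1−δ}) each; |B| is the prime-free version (integers
in a progression, trivial level). Choose δ = δ(ε,t). [difficulty: L] -/
@[route_item "route-Parity-HyperbolicConstellations", crux]
def SinglesFromPNT : Prop :=
  PrimorialPNT → SinglesOnBlocks

/-- item stmt-Parity-10139 · support · rank 9 · open · by planner
sources: Dickson1904, HardyLittlewood1923, GreenTao2010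
[support] (output of the transfer, input of the desieving) for all t, L, ε > 0 there is N₀ with:
uniformly in the data of crux 2, |N_t·|B|^{t−1} − ∏_i S_i| ≤ (8t²/w + εϖ^t)·∏_i S_i, N_t = #{n ∈ B :
all ψ_i(n) prime}. The Hardy–Littlewood value of N_t|B|^{t−1}/∏S_i is D(Ψ,w) =
∏_{p>w,p∤Δ}(1−t/p)(1−1/p)^{−t} ∈ [1 − t²/w, 1] (job j001440: 0.81–0.83 at t = 3, 0.61–0.64 at t = 4
for w = 5, as predicted), whence the allowance 8t²/w; εϖ^t is the summable part. [difficulty: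
open-problem] -/
@[route_item "route-Parity-HyperbolicConstellations", crux]
def TuplesOnBlocks : Prop :=
  ∀ (t L : ℕ), 1 ≤ t → ∀ ε : ℝ, 0 < ε → ∃ N₀ : ℕ, ∀ N : ℕ, N₀ ≤ N → ∀ w : ℕ, L ≤ w → (primorial w : ℝ) ≤ Real.exp (Real.log (Real.log N) ^ (t + 1)) → ∀ Ψ : Fin t → Literature.NumberTheory.Sieve.AffLinForm 1, Literature.NumberTheory.Sieve.IsNondegenerateSystem Ψ → Literature.NumberTheory.Sieve.affLinSize Ψ N ≤ L → ∀ (u v b : ℤ), -(N : ℤ) ≤ u → v ≤ N → (N : ℝ) ≤ (v - u : ℝ) * Real.log N ^ (t + 2) → (∀ i, 0 < (Ψ i).eval (fun _ => u) ∧ 0 < (Ψ i).eval (fun _ => v)) → (∀ i, Int.gcd ((Ψ i).eval (fun _ => b)) (primorial w) = 1) → (let Δ : ℤ := (∏ i, (Ψ i).coeff 0) * ∏ i, ∏ j, (if i < j then (Ψ i).coeff 0 * (Ψ j).const - (Ψ j).coeff 0 * (Ψ i).const else 1); let B : Finset ℤ := (Finset.Icc u v).filter (fun n => n ≡ b [ZMOD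 (primorial w : ℤ)] ∧ ∀ i, Int.gcd ((Ψ i).eval (fun _ => n)) Δ = 1); let ν : ℕ → ℕ := fun p => ((Finset.range p).filter (fun r => (p : ℤ) ∣ ∏ i, (Ψ i).eval (fun _ => (r : ℤ)))).card; let P : Finset ℕ := (Int.natAbs Δ).primeFactors.filter (fun p => w < p); let c₀ : ℝ := ∏ p ∈ P, (1 - (ν p : ℝ) / (p : ℝ)); let ϖ : ℝ := c₀ * (Nat.totient (primorial w) : ℝ) / (primorial w : ℝ); |((B.filter (fun n => ∀ i, ((Ψ i).eval (fun _ => n)).toNat.Prime)).card : ℝ) * (B.card : ℝ) ^ (t - 1) - ∏ i, ((B.filter (fun n => ((Ψ i).eval (fun _ => n)).toNat.Prime)).card : ℝ)| ≤ (8 * (t : ℝ) ^ 2 / (w : ℝ) + ε * ϖ ^ t) * ∏ i, ((B.filter (fun n => ((Ψ i).eval (fun _ => n)).toNat.Prime)).card : ℝ))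

/-- item stmt-Parity-10140 · support · rank 9 · open · by planner
sources: BorceaBrandenLiggett2007, PolyaSzego1925
[support] PROVABLE NOW (Poisson-binomial algebra, ≈ 500 Lean lines): ConstellationHyperbolicity →
PairLowerBound → SinglesOnBlocks → TuplesOnBlocks. A real-rooted Σ_{j≤t}N_jX^j with N_j ≥ 0, N_0 > 0
is c∏_{l≤m}(X + r_l), r_l > 0 (Polynomial.Splits, roots); with p_l = 1/(1+r_l): Σp_l = Σ_j jN_j/|B|
= Σ_iS_i/|B| =: s, Σ_{l≠l'}p_lp_l' = Σ_j j(j−1)N_j/|B| = Σ_{i≠j}S_ij/|B|, N_m/|B| = ∏p_l. Put p_l =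
(s/t)(1+u_l) (Σu_l = 0, U = Σu_l²): PairLowerBound and SinglesOnBlocks (S_i = common M₁·(1 ± εϖ^t))
give U ≤ t(t−1)[(1 − r) + ηϖ^{2t}] + 9tε²ϖ^{2t} with 1 − r ≤ Σ_{p>w}(p−1)^{−2} ≤ 2/w; Cauchy–Schwarz
Σp_l² ≥ s²/m forces m = t once U < 1; AM–GM and log(1+u) ≥ u − u² give ∏(1+u_l) ∈ [1 − U, 1] and
∏(S_i/|B|)/(s/t)^t ∈ [1 − Σδ_i², 1]; hence |N_t|B|^{t−1} − ∏S_i| ≤ (U + 2Σδ²)∏S_i ≤ (8t²/w +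
ε'ϖ^t)∏S_i. For 8t²/w ≥ 1 only the upper half is non-trivial and it needs no smallness. Degenerate
cases (S_i = 0, B = ∅, t = 1) are trivial. [difficulty: provable-now] -/
@[route_item "route-Parity-HyperbolicConstellations", crux]
def HyperbolicTransfer : Prop :=
  ConstellationHyperbolicity → PairLowerBound → SinglesOnBlocks → TuplesOnBlocks

/-- item stmt-Parity-10141 · support · rank 9 · open · by planner
sources: GreenTao2010, Gallagher1976, HardyLittlewood1923
[support] PROVABLE (sizable bookkeeping, no arithmetic beyond SinglesOnBlocks): TuplesOnBlocks →
SinglesOnBlocks → DimOne. Given ε take w = ⌈8t²(3e^γ log log N)^{t−1}/ε⌉ (allowed: primorial w ≤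
exp((log log N)^{t+1})). Cut K ∩ ℤ ⊆ [−N,N] at the roots of the forms into ≤ t+1 sign-constant
pieces; pieces where a form is ≤ 0 contribute 0 = their β_∞ share; pieces shorter than N/(log
N)^{t+2} contribute ≤ 2^tN/(log N)²; on long positive pieces split n mod W: non-admissible classes
carry only prime-power values (O(W·t(log N)^{t+1})), prime powers cost O(t√N log^{t+1}N), tuples
with some ψ_i(n) | Δ at most t·ω(Δ) points; on admissible classes TuplesOnBlocks × SinglesOnBlocks
give N_t(B_b) = M₁^t/M₀^{t−1} ± (8t²/w + 3tεϖ^t)M₁^t/M₀^{t−1}, and Σ_{b adm}M₁^t/M₀^{t−1} =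
(v−u)(log N)^{−t}∏_{p≤w}β_p∏_{p|Δ,p>w}β_p because #adm = ∏_{p≤w}(p−ν_p) (CRT), localFactor Ψ p =
(p/(p−1))^t(1−ν_p/p) at d = 1 and Π₁^tΠ₀^{1−t} = ∏(1−ν_p/p)(1−1/p)^{−t}; the error sums to ≤
[8t²/w·(3e^γ log log N)^{t−1} + 3tε]·(v−u)(log N)^{−t} since ϖ^t∏β_p ≤ ϖ ≤ 1 and ∏_{p≤w or p|Δ}β_p ≤
(3e^γ log log N)^{t−1}; the omitted primes p > w, p ∤ Δ have β_p ∈ [1 − t²/p², 1]; singularProduct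
is the limit (tendsto_singularProductPar -/
@[route_item "route-Parity-HyperbolicConstellations", crux]
def BlocksToDimOne : Prop :=
  TuplesOnBlocks → SinglesOnBlocks → DimOne

/-- item stmt-Parity-10142 · support · rank 9 · open · by planner
sources: PolyaSzego1925, BorceaBranden2009, BorceaBrandenLiggett2007
[support] PROVABLE NOW (card P1, the mechanism's anchor; Lean-sized): for every k and every finite
set P of primes all > k, the model rank polynomial Σ_{j≤k} C(k,j)·∏_{p∈P}(1 − j/p)·X^j — the
expected rank polynomial of k forms with pairwise distinct roots mod every p ∈ P under the
CRT/Kubilius measure — splits over ℝ. Proof: it is ∏_{p∈P} p^{−1}(p − X·d/dX) applied to (1+X)^k; if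
f has k < p negative real roots then X f′ − p f = X^{p+1}(X^{−p}f)′ has k−1 Rolle roots between
consecutive roots of f (multiplicities counted) and one in (−∞, r_min) because X^{−p}f → 0 at −∞, so
it is again real-rooted with negative roots (equivalently Schur–Szegő composition with
(1+X)^{k−1}(1+(1−k/p)X), PolyaSzego1925 Part V). Delimiter (card): with a coincident root mod p the
model is not even Rayleigh — whence the collision sifting in B. [difficulty: provable-now] -/
@[route_item "route-Parity-HyperbolicConstellations", crux]
def KubiliusModelHyperbolic : Prop :=
  ∀ (k : ℕ) (P : Finset ℕ), (∀ p ∈ P, p.Prime ∧ k < p) → (∑ j ∈ Finset.range (k + 1), Polynomial.C ((k.choose j : ℝ) * ∏ p ∈ P, (1 - (j : ℝ) / (p : ℝ))) * Polynomial.X ^ j).Splits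

/-- item stmt-Parity-10143 · assembly · rank 1 · open · by planner
sources: GreenTao2010, BorceaBrandenLiggett2007
[assembly] ConstellationHyperbolicity → PairLowerBound → PrimorialPNT → SinglesFromPNT →
HyperbolicTransfer → BlocksToDimOne → FibrationLemma → GeneralizedHardyLittlewood. -/
@[route_item "route-Parity-HyperbolicConstellations", crux]
def Assembly : Prop :=
  ConstellationHyperbolicity → PairLowerBound → PrimorialPNT → SinglesFromPNT → HyperbolicTransfer → BlocksToDimOne → FibrationLemma → GeneralizedHardyLittlewood

/-! D-0027 §2.1 — DECIDING THEOREM (planner-authored via `route open/edit --closes-file`; by planner-plancard-Parity-GeneralizedHardyLittl-3b73a515-0 2026-08-15T15:13:34Z):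
its hypotheses are this route's items and its conclusion the sub-problem Statement (glue_lint), and it elaborates with this file. -/

/-- D-0027 §2.1 deciding theorem of route HyperbolicConstellations: the items decide the sub-problem
Statement `GeneralizedHardyLittlewood` (pure logic: PrimorialPNT gives the singles via SinglesFromPNT, the transfer
turns hyperbolicity, the binary lower bound and the singles into k-tuples on blocks, the desieving gives DimOne, the
fibration lemma gives GHL; the target DimOne, SinglesOnBlocks, TuplesOnBlocks, KubiliusModelHyperbolic and Assembly are
carried as hypotheses but not used). -/
@[closes "route-Parity-HyperbolicConstellations"] theorem closes : DimOne → ConstellationHyperbolicity → PairLowerBound → PrimorialPNT → SinglesOnBlocks → SinglesFromPNT → TuplesOnBlocks → HyperbolicTransfer → BlocksToDimOne → FibrationLemma → KubiliusModelHyperbolic → Assembly → _root_.GeneralizedHardyLittlewood :=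
  fun _ hA hP hN _ hSP _ hT hD hF _ _ => hF (hD (hT hA hP (hSP hN)) (hSP hN))

end Summit.Parity.GeneralizedHardyLittlewood.Theses.HyperbolicConstellations
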